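import Mathlib
import Literature.Analysis.FluidPDE.VectorCalculus

/-!
# The regularised Biot–Savart field of a straight vortex line

Tools stub `stub_lineBiotSavart` of line `Sketch` (crux `SkeletonEquilibrium`, thesis
`FilamentSkeletonRss`). For the Rosenhead-regularised (core `1`) Biot–Savart kernel and a straight
line `σ ↦ P + σ • e` with `‖e‖ = 1`, the induced field at `x` is available in closed form:
with `v = x − P`, `s₀ = ⟨v, e⟩` and `A = ‖v‖² − s₀² + 1 ≥ 1`, one has `x − (P + σe) = v − σe`,
`e × (v − σe) = e × v` and `‖v − σe‖² + 1 = (σ − s₀)² + A`, so the integrand is the scalar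
Rosenhead line kernel `((σ − s₀)² + A)^{-3/2}` times the constant vector `e × v`; the scalar kernel
has the primitive `u ↦ u / (A √(u² + A))` with limits `±1/A` at `±∞`, whence
`∫ ((σ − s₀)² + A)^{-3/2} dσ = 2 / A` (the Lorentzian in the squared distance `A − 1` from `x`
to the line). Everything is Mathlib (`integral_of_hasDerivAt_of_tendsto`,
`integrable_inv_one_add_sq`, translation invariance, `integral_smul_const`) plus the tree's
bilinear `crossCLM`.
-/

noncomputable section

open MeasureTheory Filter Topology
open Literature.Analysis.FluidPDE

namespace Summit.NavierStokesRegularity.NavierStokesRegularity.Theorems.SkeletonEquilibrium.Sketch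
set_option linter.dupNamespace false

/-- `b ^ (3/2) = b √b` for `0 < b` (also in e.g.
`Literature/NumberTheory/LFunctions/SchoenfeldPsiTheta.lean`, an unrelated file not worth
importing; re-proved privately). [folklore] -/
private theorem rpow_three_halves_eq_mul_sqrt {b : ℝ} (hb : 0 < b) :
    b ^ (3 / 2 : ℝ) = b * Real.sqrt b := by
  rw [show (3 / 2 : ℝ) = 1 + 1 / 2 by norm_num, Real.rpow_add hb, Real.rpow_one, Real.sqrt_eq_rpow]

/-- The Rosenhead line kernel `((u² + A)^{3/2})⁻¹`, `A ≥ 1`, is integrable on `ℝ`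
(domination by `(1 + u²)⁻¹`). [folklore] -/
private theorem integrable_lineKernel {A : ℝ} (hA : 1 ≤ A) :
    Integrable fun u : ℝ => ((u ^ 2 + A) ^ (3 / 2 : ℝ))⁻¹ := by
  have hA0 : 0 < A := by linarith
  have hb : ∀ u : ℝ, 0 < u ^ 2 + A := fun u => by positivity
  have hc : Continuous fun u : ℝ => ((u ^ 2 + A) ^ (3 / 2 : ℝ))⁻¹ :=
    (((continuous_pow 2).add continuous_const).rpow_const fun u => Or.inr (by norm_num)).inv₀
      fun u => (Real.rpow_pos_of_pos (hb u) _).ne'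
  refine integrable_inv_one_add_sq.mono' hc.aestronglyMeasurable (Eventually.of_forall fun u => ?_)
  rw [norm_inv, Real.norm_of_nonneg (Real.rpow_nonneg (hb u).le _),
    rpow_three_halves_eq_mul_sqrt (hb u)]
  refine inv_anti₀ (by positivity) ?_
  have hs : 1 ≤ Real.sqrt (u ^ 2 + A) := Real.one_le_sqrt.2 (by nlinarith [sq_nonneg u])
  have := mul_le_mul_of_nonneg_left hs (hb u).le
  nlinarith [sq_nonneg u]

/-- The primitive `u ↦ u / (A √(u² + A))` of the Rosenhead line kernel. [folklore] -/
private theorem hasDerivAt_lineKernel_primitive {A : ℝ} (hA : 0 < A) (u : ℝ) :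
    HasDerivAt (fun u : ℝ => u / (A * Real.sqrt (u ^ 2 + A)))
      (((u ^ 2 + A) ^ (3 / 2 : ℝ))⁻¹) u := by
  have hb : 0 < u ^ 2 + A := by positivity
  have hs : 0 < Real.sqrt (u ^ 2 + A) := Real.sqrt_pos.2 hb
  have h1 : HasDerivAt (fun u : ℝ => u ^ 2 + A) (2 * u) u := by
    simpa using (hasDerivAt_pow 2 u).add_const A
  have h2 : HasDerivAt (fun u : ℝ => A * Real.sqrt (u ^ 2 + A))
      (A * (2 * u / (2 * Real.sqrt (u ^ 2 + A)))) u :=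
    (h1.sqrt hb.ne').const_mul A
  refine ((hasDerivAt_id' u).div h2 (mul_pos hA hs).ne').congr_deriv ?_
  rw [rpow_three_halves_eq_mul_sqrt hb]
  have hsq : Real.sqrt (u ^ 2 + A) ^ 2 = u ^ 2 + A := Real.sq_sqrt hb.le
  generalize Real.sqrt (u ^ 2 + A) = s at hs hsq ⊢
  rw [← hsq]
  field_simp
  linear_combination hsq

/-- `u / √(u² + A) → 1` as `u → +∞` (`A > 0`). [folklore] -/
private theorem tendsto_div_sqrt_sq_add_atTop {A : ℝ} (hA : 0 < A) :
    Tendsto (fun u : ℝ => u / Real.sqrt (u ^ 2 + A)) atTop (𝓝 1) := by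
  have h1 : Tendsto (fun u : ℝ => A / (u ^ 2 + A)) atTop (𝓝 0) :=
    tendsto_const_nhds.div_atTop (tendsto_atTop_add_const_right _ _ (tendsto_pow_atTop two_ne_zero))
  have h2 : Tendsto (fun u : ℝ => Real.sqrt (1 - A / (u ^ 2 + A))) atTop (𝓝 1) := by
    simpa using ((tendsto_const_nhds : Tendsto (fun _ : ℝ => (1 : ℝ)) atTop (𝓝 1)).sub h1).sqrt
  refine h2.congr' ?_
  filter_upwards [eventually_ge_atTop (0 : ℝ)] with u hu
  have hb : 0 < u ^ 2 + A := by positivity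
  rw [show 1 - A / (u ^ 2 + A) = u ^ 2 / (u ^ 2 + A) by field_simp; ring,
    Real.sqrt_div' _ hb.le, Real.sqrt_sq hu]

/-- `∫ ((u² + A)^{3/2})⁻¹ du = 2 / A` over `ℝ` (`A ≥ 1`), by the fundamental theorem of calculus on
`(-∞, ∞)` with the primitive `u / (A √(u² + A)) → ±1/A`. [folklore] -/
private theorem integral_lineKernel {A : ℝ} (hA : 1 ≤ A) :
    ∫ u : ℝ, ((u ^ 2 + A) ^ (3 / 2 : ℝ))⁻¹ = 2 / A := by
  have hA0 : 0 < A := by linarith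
  have htop : Tendsto (fun u : ℝ => u / (A * Real.sqrt (u ^ 2 + A))) atTop (𝓝 A⁻¹) := by
    have h := (tendsto_div_sqrt_sq_add_atTop hA0).const_mul A⁻¹
    rw [mul_one] at h
    refine h.congr fun u => ?_
    ring
  have hbot : Tendsto (fun u : ℝ => u / (A * Real.sqrt (u ^ 2 + A))) atBot (𝓝 (-A⁻¹)) := by
    refine ((htop.comp tendsto_neg_atBot_atTop).neg).congr fun u => ?_
    simp only [Function.comp_apply, neg_sq, neg_div, neg_neg]
  rw [integral_of_hasDerivAt_of_tendsto (hasDerivAt_lineKernel_primitive hA0)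
    (integrable_lineKernel hA) hbot htop]
  ring

/-- `e × (v − σ e) = e × v` (bilinearity and `e × e = 0`). [folklore] -/
private theorem cross_sub_smul_self (e v : EuclideanSpace ℝ (Fin 3)) (σ : ℝ) :
    cross e (v - σ • e) = cross e v := by
  rw [← crossCLM_apply, map_sub, map_smul, crossCLM_apply, crossCLM_apply]
  have : cross e e = 0 := by simp [cross]
  rw [this, smul_zero, sub_zero]

/-- `‖v − σ e‖² + 1 = (σ − ⟨v, e⟩)² + (‖v‖² − ⟨v, e⟩² + 1)` for a unit vector `e`. [folklore] -/
private theorem norm_sub_smul_sq_add_one (e v : EuclideanSpace ℝ (Fin 3)) (he : ‖e‖ = 1) (σ : ℝ) :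
    ‖v - σ • e‖ ^ 2 + 1 = (σ - inner ℝ v e) ^ 2 + (‖v‖ ^ 2 - (inner ℝ v e) ^ 2 + 1) := by
  rw [norm_sub_sq_real, real_inner_smul_right, norm_smul, Real.norm_eq_abs, he, mul_one, sq_abs]
  ring

/-- The line field in the variable `v = x − P`: integrability and the closed form. [folklore] -/
private theorem lineBiotSavart_aux (e v : EuclideanSpace ℝ (Fin 3)) (he : ‖e‖ = 1) :
    Integrable (fun σ : ℝ => ((‖v - σ • e‖ ^ 2 + 1) ^ (3 / 2 : ℝ))⁻¹ • cross e (v - σ • e)) ∧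
      ∫ σ : ℝ, ((‖v - σ • e‖ ^ 2 + 1) ^ (3 / 2 : ℝ))⁻¹ • cross e (v - σ • e)
        = (2 / (‖v‖ ^ 2 - (inner ℝ v e) ^ 2 + 1)) • cross e v := by
  have hA1 : 1 ≤ ‖v‖ ^ 2 - (inner ℝ v e) ^ 2 + 1 := by
    have h : |inner ℝ v e| ≤ ‖v‖ := by simpa [he] using abs_real_inner_le_norm v e
    have h' := abs_le.mp h
    nlinarith [sq_le_sq' h'.1 h'.2]
  have hfun : (fun σ : ℝ => ((‖v - σ • e‖ ^ 2 + 1) ^ (3 / 2 : ℝ))⁻¹ • cross e (v - σ • e))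
      = fun σ => (((σ - inner ℝ v e) ^ 2 + (‖v‖ ^ 2 - (inner ℝ v e) ^ 2 + 1)) ^ (3 / 2 : ℝ))⁻¹ •
          cross e v := by
    funext σ
    rw [cross_sub_smul_self, norm_sub_smul_sq_add_one e v he σ]
  rw [hfun, integral_smul_const]
  refine ⟨((integrable_lineKernel hA1).comp_sub_right (inner ℝ v e)).smul_const _, ?_⟩
  rw [(integral_sub_right_eq_self (fun u : ℝ => ((u ^ 2 + (‖v‖ ^ 2 - (inner ℝ v e) ^ 2 + 1)) ^
    (3 / 2 : ℝ))⁻¹) (inner ℝ v e)).trans (integral_lineKernel hA1)]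

/-- **Tools stub T1** (`stub_lineBiotSavart`): the regularised (core `1`) Biot–Savart field of a
straight vortex line `σ ↦ P + σ • e` (`‖e‖ = 1`) at a point `x`, in closed form — the Rosenhead
kernel integrates along the line to the Lorentzian `2 / (d² + 1)`,
`d² = ‖x − P‖² − ⟨x − P, e⟩²` the squared distance from `x` to the line:
`∫ ((‖x − (P + σe)‖² + 1)^{3/2})⁻¹ • e × (x − (P + σe)) dσ = (2 / (d² + 1)) • e × (x − P)`,
and the integrand is Bochner integrable. [folklore] -/
theorem stub_lineBiotSavart : ∀ (P e x : EuclideanSpace ℝ (Fin 3)), ‖e‖ = 1 → MeasureTheory.Integrable (fun σ : ℝ => ((‖x - (P + σ • e)‖ ^ 2 + 1) ^ (3 / 2 : ℝ))⁻¹ • Literature.Analysis.FluidPDE.cross e (x - (P + σ • e))) ∧ ∫ σ : ℝ, ((‖x - (P + σ • e)‖ ^ 2 + 1) ^ (3 / 2 : ℝ))⁻¹ • Literature.Analysis.FluidPDE.cross e (x - (P + σ • e)) = (2 / (‖x - P‖ ^ 2 - (inner ℝ (x - P) e) ^ 2 + 1)) • Literature.Analysis.FluidPDE.cross e (x - P)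 := by
  intro P e x he
  simp only [sub_add_eq_sub_sub]
  exact lineBiotSavart_aux e (x - P) he

end Summit.NavierStokesRegularity.NavierStokesRegularity.Theorems.SkeletonEquilibrium.Sketch
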